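import Literature.Algebra.Lie.SurfaceGroupMagnus
import Summits.SmoothPoincare4.SmoothPoincare4.Theorems.CongruenceShadowsLieGateIdentityDerivations
import HarnessLib

/-!
# Johnson data of `𝒥ₖ`-automorphisms of the surface group are derivation data (all genera, all `k ≥ 1`)

Helper for stub `stub_nilpotentLayerStep` (and its neighbour `stub_layerStepZero`) of the line
`nilpotent-genus-class` for crux `CongruenceShadows.ShadowApproximation` (item stmt-SmoothPoincare4-14595).

Let `G` be a group with lower central series `γₙ = lcs G n` (Mathlib numbering, `γ₀ = G`) and `gr(G)` its
Lie ring (`Literature.GroupTheory.CombinatorialGroupTheory.GrLCS`, symbol maps `toGr`).  For `k ≥ 1` and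
`s, t ∈ γₖ`,
  `⁅s·a, t·b⁆ = ⁅a, b⁆ · w`  with  `w ∈ γ_{k+1}`  and  `toGr (k+1) w = ⁅ā, t̄⁆ - ⁅b̄, s̄⁆`
(`exists_commutator_mul_mul_eq`), and the same for finite products (`exists_prod_commutator_eq`).  Hence if an
endomorphism `ψ` of `G` satisfies `ψ x · x⁻¹ ∈ γₖ` for all `x` (it lies in the `k`-th term of the Johnson /
Andreadakis filtration) and `∏ᵢ ⁅aᵢ, bᵢ⁆ = 1`, then applying `ψ` to the relation gives the LINEAR identity
  `∑ᵢ (⁅toGr 0 aᵢ, toGr k (ψ bᵢ · bᵢ⁻¹)⁆ - ⁅toGr 0 bᵢ, toGr k (ψ aᵢ · aᵢ⁻¹)⁆) = 0`  in `gr(G)`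
(`sum_johnsonData_eq_zero`, `surfaceGroup_sum_johnsonData_eq_zero`): the Johnson datum
`x ↦ toGr k (ψ x · x⁻¹)` kills the symbol of the relator, i.e. it is a DERIVATION datum in the sense of
`Summit.SmoothPoincare4.SmoothPoincare4.Theorems.LieGateIdentity.exists_derivation`.  Through Labute's
isomorphism `Φ : 𝔰_g(ℤ) ≅ gr(S_g)` (`Literature.Algebra.Lie.SurfaceGr.Phi`, surjective degreewise and injective in
degrees `≥ 2`, all proved in the tree) this yields an honest degree-`k` derivation `D` of the surface Lie algebra
`𝔰_{g+1}(ℤ)` with `Φ (D xᵢ) = toGr k (ψ xᵢ · xᵢ⁻¹)` on every letter (`exists_lieDerivation_of_johnson`): the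
`k`-th Johnson homomorphism `τₖ : 𝒥ₖ(Aut S_g) → Derₖ(𝔰_g)` of the informal plan (Johnson 1980, Morita 1993 §4 for
mapping classes; here for all automorphisms, including `Inn`).  Everything is proved; no definitions, no named facts.
-/

set_option linter.dupNamespace false

open scoped commutatorElement
open Literature.GroupTheory.CombinatorialGroupTheory Literature.Topology.FourManifolds Literature.Algebra.Lie

namespace Summit.SmoothPoincare4.SmoothPoincare4.Theorems.ShadowApproximation.NilpotentGenusClass

section General

variable {G : Type*} [Group G]

/-- **One handle.** For `k ≥ 1`, `s, t ∈ γₖ` and any `a, b`: `⁅s a, t b⁆ = ⁅a, b⁆ · w` with `w ∈ γ_{k+1}` and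
`toGr (k+1) w = ⁅toGr 0 a, toGr k t⁆ - ⁅toGr 0 b, toGr k s⁆` (the first-order variation of a commutator).
[folklore] -/
theorem exists_commutator_mul_mul_eq {k : ℕ} (hk : 1 ≤ k) (a b : G) {s t : G} (hs : s ∈ lcs G k)
    (ht : t ∈ lcs G k) :
    ∃ w ∈ lcs G (k + 1), ⁅s * a, t * b⁆ = ⁅a, b⁆ * w ∧
      toGr G (k + 1) w = ⁅toGr G 0 a, toGr G k t⁆ - ⁅toGr G 0 b, toGr G k s⁆ := by
  have ha : a ∈ lcs G 0 := Subgroup.mem_top a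
  have hb : b ∈ lcs G 0 := Subgroup.mem_top b
  -- the four pieces
  have hab : ⁅a, b⁆ ∈ lcs G 1 := commutator_mem_lcs_of_eq (N := 1) (by omega) ha hb
  have h1 : ⁅a, t⁆ ∈ lcs G (k + 1) := commutator_mem_lcs_of_eq (N := k + 1) (by omega) ha ht
  have h2' : ⁅s * t, ⁅a, b⁆⁆ ∈ lcs G (k + 1 + 1) :=
    commutator_mem_lcs_of_eq (N := k + 1 + 1) (by omega) (mul_mem hs ht) hab
  have h2 : ⁅s * t, ⁅a, b⁆⁆ ∈ lcs G (k + 1) := lcs_antitone (Nat.le_succ _) h2'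
  have h3 : ⁅s, t⁆ ∈ lcs G (k + 1 + 1) :=
    lcs_antitone (show k + 1 + 1 ≤ k + k + 1 by omega) (commutator_mem_lcs hs ht)
  have h4 : ⁅s, b⁆ ∈ lcs G (k + 1) := commutator_mem_lcs_of_eq (N := k + 1) (by omega) hs hb
  set q : G := s * ⁅a, t⁆ * s⁻¹ * ⁅s * t, ⁅a, b⁆⁆ with hq_def
  have hq : q ∈ lcs G (k + 1) := mul_mem (conj_mem_lcs s h1) h2
  set w : G := ⁅a, b⁆⁻¹ * q * ⁅a, b⁆⁻¹⁻¹ * (⁅s, t⁆ * (t * ⁅s, b⁆ * t⁻¹)) with hw_def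
  have hw : w ∈ lcs G (k + 1) :=
    mul_mem (conj_mem_lcs _ hq) (mul_mem (lcs_antitone (Nat.le_succ _) h3) (conj_mem_lcs t h4))
  refine ⟨w, hw, ?_, ?_⟩
  · simp only [hw_def, hq_def, commutatorElement_def]
    group
  · rw [hw_def, toGr_mul (conj_mem_lcs _ hq) (mul_mem (lcs_antitone (Nat.le_succ _) h3) (conj_mem_lcs t h4)),
      toGr_conj _ hq, toGr_mul (lcs_antitone (Nat.le_succ _) h3) (conj_mem_lcs t h4),
      toGr_eq_zero_of_mem_succ h3, zero_add, toGr_conj t h4, hq_def,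
      toGr_mul (conj_mem_lcs s h1) h2, toGr_conj s h1, toGr_eq_zero_of_mem_succ h2', add_zero,
      ← lie_toGr_toGr_of_eq (N := k + 1) (by omega) ha ht,
      ← lie_toGr_toGr_of_eq (N := k + 1) (by omega) hs hb,
      GrLCS.lie_skew' (toGr G k s) (toGr G 0 b), sub_eq_add_neg]

/-- **Several handles.** Same statement for a product of commutators over a list. [folklore] -/
theorem exists_prod_commutator_eq {k : ℕ} (hk : 1 ≤ k) {ι : Type*} (a b s t : ι → G)
    (hs : ∀ i, s i ∈ lcs G k) (ht : ∀ i, t i ∈ lcs G k) (l : List ι) :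
    ∃ w ∈ lcs G (k + 1),
      (l.map fun i => ⁅s i * a i, t i * b i⁆).prod = (l.map fun i => ⁅a i, b i⁆).prod * w ∧
      toGr G (k + 1) w =
        (l.map fun i => ⁅toGr G 0 (a i), toGr G k (t i)⁆ - ⁅toGr G 0 (b i), toGr G k (s i)⁆).sum := by
  induction l with
  | nil => exact ⟨1, one_mem _, by simp, by simp⟩
  | cons i l ih =>
    obtain ⟨W, hW, hprod, hsum⟩ := ih
    obtain ⟨w, hw, hcomm, htoGr⟩ := exists_commutator_mul_mul_eq hk (a i) (b i) (hs i) (ht i)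
    set P : G := (l.map fun i => ⁅a i, b i⁆).prod with hP
    refine ⟨P⁻¹ * w * P⁻¹⁻¹ * W, mul_mem (conj_mem_lcs _ hw) hW, ?_, ?_⟩
    · simp only [List.map_cons, List.prod_cons, hprod, hcomm, ← hP]
      group
    · rw [toGr_mul (conj_mem_lcs _ hw) hW, toGr_conj _ hw, htoGr, hsum, List.map_cons, List.sum_cons]

/-- **Johnson data are derivation data (abstract form).** If `∏_{i ∈ l} ⁅aᵢ, bᵢ⁆ = 1` in `G` and the
endomorphism `ψ` satisfies `ψ x · x⁻¹ ∈ γₖ` for all `x` (`k ≥ 1`), then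
`∑_{i ∈ l} (⁅toGr 0 aᵢ, toGr k (ψ bᵢ · bᵢ⁻¹)⁆ - ⁅toGr 0 bᵢ, toGr k (ψ aᵢ · aᵢ⁻¹)⁆) = 0` in `gr(G)`. [folklore] -/
theorem sum_johnsonData_eq_zero {k : ℕ} (hk : 1 ≤ k) {ι : Type*} (a b : ι → G) (l : List ι)
    (hrel : (l.map fun i => ⁅a i, b i⁆).prod = 1) (ψ : G →* G) (hψ : ∀ x, ψ x * x⁻¹ ∈ lcs G k) :
    (l.map fun i => ⁅toGr G 0 (a i), toGr G k (ψ (b i) * (b i)⁻¹)⁆ -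
      ⁅toGr G 0 (b i), toGr G k (ψ (a i) * (a i)⁻¹)⁆).sum = 0 := by
  obtain ⟨w, hw, hprod, hsum⟩ := exists_prod_commutator_eq hk a b (fun i => ψ (a i) * (a i)⁻¹)
    (fun i => ψ (b i) * (b i)⁻¹) (fun i => hψ (a i)) (fun i => hψ (b i)) l
  have e' : (fun i => ⁅ψ (a i) * (a i)⁻¹ * a i, ψ (b i) * (b i)⁻¹ * b i⁆) =
      (⇑ψ ∘ fun i => ⁅a i, b i⁆) := by
    funext i
    simp [map_commutatorElement]
  have e : (l.map fun i => ⁅ψ (a i) * (a i)⁻¹ * a i, ψ (b i) * (b i)⁻¹ * b i⁆).prod =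
      ψ (l.map fun i => ⁅a i, b i⁆).prod := by
    rw [e', map_list_prod, List.map_map]
  rw [e, hrel, map_one, one_mul] at hprod
  rw [← hsum, ← hprod, toGr_one]

end General

/-! ## The surface group -/

/-- **Johnson data of a `𝒥ₖ`-endomorphism of `S_g` are derivation data**: for `ψ : S_g →* S_g` with
`ψ x · x⁻¹ ∈ γₖ(S_g)` for all `x` (`k ≥ 1`),
`∑ᵢ (⁅toGr 0 aᵢ, toGr k (ψ bᵢ · bᵢ⁻¹)⁆ - ⁅toGr 0 bᵢ, toGr k (ψ aᵢ · aᵢ⁻¹)⁆) = 0` in `gr(S_g)` — the symbol of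
`ψ(∏ᵢ ⁅aᵢ, bᵢ⁆) = 1`. [folklore] -/
theorem surfaceGroup_sum_johnsonData_eq_zero (g : ℕ) {k : ℕ} (hk : 1 ≤ k)
    (ψ : SurfaceGroup g →* SurfaceGroup g) (hψ : ∀ x, ψ x * x⁻¹ ∈ lcs (SurfaceGroup g) k) :
    ∑ i : Fin g, (⁅toGr (SurfaceGroup g) 0 (SurfaceGroup.a i),
        toGr (SurfaceGroup g) k (ψ (SurfaceGroup.b i) * (SurfaceGroup.b i)⁻¹)⁆ -
      ⁅toGr (SurfaceGroup g) 0 (SurfaceGroup.b i),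
        toGr (SurfaceGroup g) k (ψ (SurfaceGroup.a i) * (SurfaceGroup.a i)⁻¹)⁆) = 0 := by
  rw [Fin.sum_univ_def]
  exact sum_johnsonData_eq_zero hk (fun i => SurfaceGroup.a (g := g) i) (fun i => SurfaceGroup.b i)
    (List.finRange g) (SurfaceGr.prod_commutator_a_b_eq_one g) ψ hψ

/-- **The `k`-th Johnson homomorphism lands in `Derₖ(𝔰)`** (all genera `g+1 ≥ 1`, all `k ≥ 1`): for
`ψ : S_{g+1} →* S_{g+1}` with `ψ x · x⁻¹ ∈ γₖ` for all `x` there is a Lie derivation `D` of the surface Lie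
algebra `𝔰_{g+1}(ℤ)` of degree `k` (`D ∈ Der_k = SurfaceLieAlgebra.derDegree ℤ (g+1) k`) whose value on each
letter is carried by Labute's isomorphism `Φ` to the Johnson datum `toGr k (ψ x · x⁻¹)`; `D` is unique with these
values (`LieGateIdentity.derivation_ext`, injectivity of `Φ` in degree `k+1 ≥ 2`). [folklore] -/
theorem exists_lieDerivation_of_johnson (g : ℕ) {k : ℕ} (hk : 1 ≤ k)
    (ψ : SurfaceGroup (g + 1) →* SurfaceGroup (g + 1))
    (hψ : ∀ x, ψ x * x⁻¹ ∈ lcs (SurfaceGroup (g + 1)) k) :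
    ∃ D ∈ SurfaceLieAlgebra.derDegree ℤ (g + 1) k,
      ∀ x, SurfaceGr.Phi (g + 1) (D (SurfaceLieAlgebra.gen ℤ (g + 1) x)) =
        toGr (SurfaceGroup (g + 1)) k (ψ (PresentedGroup.of x) * (PresentedGroup.of x)⁻¹) := by
  -- lift each Johnson datum through `Φ` (surjective degreewise)
  have hv : ∀ x : Fin (g + 1) × Bool, ∃ u ∈ SurfaceLieAlgebra.grade ℤ (g + 1) (k + 1),
      SurfaceGr.Phi (g + 1) u =
        toGr (SurfaceGroup (g + 1)) k (ψ (PresentedGroup.of x) * (PresentedGroup.of x)⁻¹) :=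
    fun x => SurfaceGr.exists_Phi_eq_toGr (g + 1) k _ (hψ _)
  choose v hv₁ hv₂ using hv
  -- the derivation condition holds because `Φ` of it is the vanishing sum of symbols, and `Φ` is injective
  have hrel : ∑ i : Fin (g + 1), (⁅SurfaceLieAlgebra.a ℤ (g + 1) i, v (i, true)⁆ -
      ⁅SurfaceLieAlgebra.b ℤ (g + 1) i, v (i, false)⁆) = 0 := by
    refine SurfaceGr.Phi_eq_zero_imp (n := k + 2) (by omega) ?_ ?_
    · refine Submodule.sum_mem _ fun i _ => sub_mem ?_ ?_
      · have := SurfaceLieAlgebra.lie_mem_grade ℤ (g + 1)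
          (SurfaceLieAlgebra.gen_mem_grade_one ℤ (g + 1) (i, false)) (hv₁ (i, true))
        rwa [show 1 + (k + 1) = k + 2 by omega] at this
      · have := SurfaceLieAlgebra.lie_mem_grade ℤ (g + 1)
          (SurfaceLieAlgebra.gen_mem_grade_one ℤ (g + 1) (i, true)) (hv₁ (i, false))
        rwa [show 1 + (k + 1) = k + 2 by omega] at this
    · rw [map_sum]
      simp only [map_sub, LieHom.map_lie, SurfaceLieAlgebra.a, SurfaceLieAlgebra.b, SurfaceGr.Phi_gen, hv₂]
      exact surfaceGroup_sum_johnsonData_eq_zero (g + 1) hk ψ hψ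
  obtain ⟨D, hD⟩ := LieGateIdentity.exists_derivation v hrel
  refine ⟨D, LieGateIdentity.mem_derDegree_iff.2 fun x => ?_, fun x => ?_⟩
  · rw [hD]; exact hv₁ x
  · rw [hD]; exact hv₂ x

end Summit.SmoothPoincare4.SmoothPoincare4.Theorems.ShadowApproximation.NilpotentGenusClass

namespace Summit.SmoothPoincare4.SmoothPoincare4.Theorems.ShadowApproximation.NilpotentGenusClass

/-- **Registered helper `helper_johnsonDerivationData`** (sub-goal of stub `stub_nilpotentLayerStep`, item
stmt-SmoothPoincare4-14595): `exists_lieDerivation_of_johnson` in closed `∀`-form with fully qualified names —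
the `k`-th Johnson datum of a `𝒥ₖ`-endomorphism of `S_{g+1}` is the generator data of a degree-`k` derivation of
`𝔰_{g+1}(ℤ)`. [folklore] -/
theorem helper_johnsonDerivationData : ∀ (g k : ℕ), 1 ≤ k → ∀ ψ : Literature.Topology.FourManifolds.SurfaceGroup (g + 1) →* Literature.Topology.FourManifolds.SurfaceGroup (g + 1), (∀ x, ψ x * x⁻¹ ∈ Literature.GroupTheory.CombinatorialGroupTheory.lcs (Literature.Topology.FourManifolds.SurfaceGroup (g + 1)) k) → ∃ D ∈ Literature.Algebra.Lie.SurfaceLieAlgebra.derDegree ℤ (g + 1) k, ∀ x : Fin (g + 1) × Bool, Literature.Algebra.Lie.SurfaceGr.Phi (g + 1) (D (Literature.Algebra.Lie.SurfaceLieAlgebra.gen ℤ (g + 1) x)) = Literature.GroupTheory.CombinatorialGroupTheory.toGr (Literature.Topology.FourManifolds.SurfaceGroup (g + 1)) k (ψ (PresentedGroup.of x) * (PresentedGroup.of x)⁻¹) :=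
  fun g _ hk ψ hψ => exists_lieDerivation_of_johnson g hk ψ hψ

end Summit.SmoothPoincare4.SmoothPoincare4.Theorems.ShadowApproximation.NilpotentGenusClass
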